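/-
Copyright: the b2b-balaban T⁴-continuum CRUX team, row NE7b OWNER lineage `t4-ne7b-p1` (gen 147). Project licence.
-/
import Summits.QuantumFields.BalabanUV.T4Continuum.Spine.NE7b.SupWeightedClassMapOrderTwo
import Summits.QuantumFields.BalabanUV.T4Continuum.Spine.NE7b.SupWeightedKernelLetterTransport

/-!
# ONE FULL STEP OF THE WEIGHTED CLASS MAP AT ORDER TWO — FLUCTUATION THEN RESCALING (SCOPING-d17 (d14)(3) ∕ (N3); file (767)).  (748)
# packaged the fluctuation step at order 2: from the INPUT's intrinsic `ϑ₂`-letters of the Hessian majorant `Hk` (+ factor letters +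
# bookkeeping) the OUTPUT `|HessW⁺(ψ)|` has weighted row∕column letters at the weaker weight `ϑ` on the SAME (fine) lattice.  The class
# iterates on the COARSE lattice: the next input is the rescaled action `W⁺∘A`, `A = t • J_β` ((429)∕(433): block map `β` with fibres of `≤ n`
# sites, field normalisation `t`), whose Hessian kernel is `t²Σ_{fibres}HessW⁺` ((433) `coarse_kernel_represents`) with entrywise majorant
# `K′(y₁,y₂) = t²Σ_{βx=y₁}Σ_{βx′=y₂}|HessW⁺(ψ)[e_{x′},e_x]|` ((766) §1), and (766) §2 transports weighted letters through `β` by exact power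
# counting times the block factor `M` of the weights (`ϑc(βx,βx′) ≤ M·ϑ(x,x′)`; exponential weights: `νc = L·ν`, `M = e^{2νc·diam∕L}`).  THIS
# FILE composes (748) and (766): the next input's row and column letters IN THE SLOT SHAPE of the class,
#   `Σ_{y₂} ϑc(y₁,y₂)·K′(y₁,y₂) ≤ t²·n·M·(hrϑ + dθ·αθ·dθ′·αθc∕(1−lamA))`,  `Σ_{y₂} ϑc(y₁,y₂)·K′(y₂,y₁) ≤ t²·n·M·(hcϑ + dθ·αθ·dθ′·αθc∕(1−lamA))`
# — «`ϑ₂`-letters of `Hk` in (fine) ⟹ `ϑc`-letters of `K′` out (coarse)», the same shape one scale up: THE LOOP OF THE WEIGHTED CLASS CLOSES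
# AT ORDER 2, the letter values multiplying by `t²·n·M` plus the two-point increment per step (row NE7b, node U5c; (748), (766) BY NAME;
# [folklore]).  Orders 3–5: (749)–(764) give the fine outputs in slot shapes; their transport is (766) §3's pattern (first-index role typed).

Cell `pub-balaban`, sub-cell `t4`, spine estimate NE7b (`T4WeightBudget.RelWeightBound`; the cell's OWN estimate — NOT PRINTED in
[Bałaban 1983–89], NOT PROVED).  Crux-route work under `Spine/NE7b/` by the row OWNER (`t4-ne7b-p1` gen 147, file (767)) under FREEZE
(0)'s crux-prover clause; NOTHING of Bałaban's is named as a Lean object, valued or asserted; no `T4Continuum/Support` leaf typed; no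
`def`, no notation (`HessW⁺(ψ)`, `K′` WRITTEN OUT); zero `sorry`.  Imports (BY NAME): (748) `…SupWeightedClassMapOrderTwo`, (766)
`…SupWeightedKernelLetterTransport`.

WHAT IS PROVED ([folklore]): **`classmap_two_step_row`**, **`classmap_two_step_col`**; toy.

HONEST (what this is NOT).  The order-2 loop of the LETTERS only: the identification of `t²Σ_{fibres}HessW⁺` with the rescaled action's Hessian is
(433)'s `coarse_kernel_represents` (met BY SHAPE, not re-proved on the display); the letter VALUES grow per step (`× t²·n·M` + increment) —
the road's smallness∕extraction (432)–(436) is NOT booked here; orders 3–5 transports beyond the first-index role are not typed; finite-torus Gaussian measure `μ_{AAᵀ}` with the road's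
regularisation; the rates are (672)∕(746); scalar skeleton ((A3), NC-NE7b-α UNRULED); nothing of Bałaban's asserted.  BY-NAME EFFECT ON THE
WALL: NONE.  NE7b NOT PRINTED ∕ NOT PROVED; spine PROVED 0∕9; rung (B)+1 — the programme's measures remain FINITE-torus statements; NOT the
mass gap, NOT Clay.  HONEST DEPENDENCY: continuum YM on T⁴ ⇐ BetaPertH ∧ nine spine estimates (0∕9 proved); BetaPertH ⇐ (D1) ∧ (D4) ∧
CAP+tail; G-an2-4 gates asym, D1 and NE2∕3∕4.
-/

set_option autoImplicit false
set_option maxSynthPendingDepth 3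

noncomputable section

namespace Summit.QuantumFields.BalabanUV.T4Continuum.NE7b.SupWeightedClassMapOrderTwoStep

open MeasureTheory ProbabilityTheory Finset Real Matrix
open scoped BigOperators Matrix
open SupWeightedClassMapOrderTwo (classmap_two_row classmap_two_col)
open SupWeightedKernelLetterTransport (weighted_coarse_rowsum_le weighted_coarse_colsum_le)
open SupWeightedProfileDischarge (letter_nonneg₁)

variable {ι κ : Type} [Fintype ι] [DecidableEq ι] [Fintype κ] [DecidableEq κ]

variable {U : EuclideanSpace ℝ ι → ℝ} {U' : EuclideanSpace ℝ ι → EuclideanSpace ℝ ι →L[ℝ] ℝ}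
  {U'' : EuclideanSpace ℝ ι → EuclideanSpace ℝ ι →L[ℝ] EuclideanSpace ℝ ι →L[ℝ] ℝ} {Hk : ι → ι → ℝ} {A : Matrix ι κ ℝ} {D : κ → κ → ℝ}
  {γop κ₀ κ₁ κ₂ a τ δ θp lamA αr αc hr γ dθ dθ' αθ αθc αrσ αcσ hrϑ hcϑ : ℝ} {θ : κ → κ → ℝ} {σ σA : ι → κ → ℝ} {ϑ ϑ₂ : ι → ι → ℝ}

/-- **ONE FULL STEP OF THE WEIGHTED CLASS AT ORDER 2, ROWS**: fluctuation ((748) `classmap_two_row`) then rescaling ((766)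
`weighted_coarse_rowsum_le`).  With `K⁺(v,u′) := |HessW⁺(ψ)[e_{u′},e_v]|` (the output majorant on the fine lattice) and the block map `β`
(fibres of `≤ n` sites), field normalisation `t` and a coarse weight dominated on block images `ϑc(βx,βx′) ≤ M·ϑ(x,x′)`, the coarse majorant
`K′(y₁,y₂) := t²Σ_{βx=y₁}Σ_{βx′=y₂}K⁺(x,x′)` — which dominates the entries of the rescaled Hessian kernel ((766) §1, (433) §4) — has the
next step's INPUT row letter in the SLOT shape: `Σ_{y₂} ϑc(y₁,y₂)·K′(y₁,y₂) ≤ t²·n·M·(hrϑ + dθ·αθ·dθ′·αθc∕(1−lamA))`.  Input shape at weight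
`ϑ₂` in, the same shape at weight `ϑc` out: THE LOOP CLOSES AT ORDER 2 (letters × `t²·n·M` per step; rates (765)). [folklore] -/
theorem classmap_two_step_row [Nonempty ι] [Nonempty κ] (hΓop : (γop • (1 : Matrix ι ι ℝ) - A * Aᵀ).PosSemidef) (Y : Finset ι)
    (hUd : ∀ φ : EuclideanSpace ℝ ι, HasFDerivAt U (U' φ) φ) (hU'd : ∀ φ : EuclideanSpace ℝ ι, HasFDerivAt U' (U'' φ) φ) (hU''c : Continuous U'')
    (hκ₀ : 0 ≤ κ₀) (hκ₁ : 0 ≤ κ₁) (ha : 0 ≤ a) (hκ₂ : 0 ≤ κ₂) (hτ : 0 < τ) (hδ : 0 < δ) (hθ0 : 0 < θp) (hθ1 : θp < 1)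
    (hκθ : (2 * κ₀ * (1 + τ) + 4 * δ) * γop ≤ θp) (hκθw : 2 * κ₀ * (1 + τ) * γop + 4 * δ ≤ θp)
    (hstab : ∀ φ : EuclideanSpace ℝ ι, -(κ₀ * ∑ x ∈ Y, φ x ^ 2) ≤ U φ) (hU'b : ∀ φ : EuclideanSpace ℝ ι, ‖U' φ‖ ≤ κ₁ * (a + ∑ x ∈ Y, φ x ^ 2))
    (hU''b : ∀ φ : EuclideanSpace ℝ ι, ‖U'' φ‖ ≤ κ₂)
    (hHk : ∀ (φ : EuclideanSpace ℝ ι) (x z : ι), |U'' φ (EuclideanSpace.single z (1 : ℝ)) (EuclideanSpace.single x (1 : ℝ))| ≤ Hk x z)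
    (hHk0 : ∀ v u, 0 ≤ Hk v u) (ψ : EuclideanSpace ℝ ι) (hαr : ∀ u, ∑ w, |A u w| ≤ αr) (hαc : ∀ w, ∑ u, |A u w| ≤ αc) (hhr : ∀ v, ∑ u, Hk v u ≤ hr)
    (hlam : ∀ x : κ, ∑ u, ∑ v, |A u x| * |A v x| * Hk v u ≤ lamA) (hlam1 : lamA < 1) (hγ : αc * hr * αr / (1 - lamA) ≤ γ) (hγ1 : γ < 1)
    (hD : ∀ x y, 0 ≤ D x y)
    (hDC : ∀ x y, (if x = y then (1 : ℝ) else 0) + ∑ z, D x z * ((if y = z then 0 else ∑ u, ∑ v, |A u y| * |A v z| * Hk v u) / (1 - lamA)) ≤ D x y)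
    (hθnn : ∀ z w, 0 ≤ θ z w) (hDθr : ∀ z', ∑ w, D z' w * θ z' w ≤ dθ) (hdθ : 0 ≤ dθ) (hDθc : ∀ w, ∑ z', D z' w * θ z' w ≤ dθ') (hdθ' : 0 ≤ dθ')
    (hσ0 : ∀ x w, 0 ≤ σ x w) (hσθ : ∀ x z' w, σ x w ≤ σ x z' * θ z' w) (hϑ1 : ∀ x y, 1 ≤ ϑ x y) (hϑ12 : ∀ x y, ϑ x y ≤ ϑ₂ x y)
    (hϑ₂symm : ∀ x y, ϑ₂ x y = ϑ₂ y x) (hϑσ : ∀ x z w, ϑ x z ≤ σ x w * σ z w)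
    (hσA0 : ∀ u z', 0 ≤ σA u z') (hσϑ₂ : ∀ v u z', σ v z' ≤ ϑ₂ v u * σA u z') (hAr : ∀ u, ∑ z', |A u z'| * σA u z' ≤ αrσ) (hαrσ : 0 ≤ αrσ)
    (hAc : ∀ z', ∑ u, |A u z'| * σA u z' ≤ αcσ) (hαcσ : 0 ≤ αcσ)
    (hhrw : ∀ a, ∑ b, ϑ₂ a b * Hk a b ≤ hrϑ) (hhc : ∀ a, ∑ b, ϑ₂ a b * Hk b a ≤ hcϑ)
    (hαθ : hrϑ * αrσ ≤ αθ) (hαθc : hcϑ * αcσ ≤ αθc)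
    {ι' : Type} [Fintype ι'] [DecidableEq ι'] (β : ι → ι') {n : ℕ} (hfib : ∀ y, (Finset.univ.filter fun x => β x = y).card ≤ n) {ϑc : ι' → ι' → ℝ}
    {M : ℝ} (hM : 0 ≤ M) (hϑc : ∀ x x', ϑc (β x) (β x') ≤ M * ϑ x x') (t : ℝ) (y₁ : ι') :
    ∑ y₂, ϑc y₁ y₂ *
        (t ^ 2 * ∑ x ∈ Finset.univ.filter (fun x => β x = y₁), ∑ x' ∈ Finset.univ.filter (fun x' => β x' = y₂),
          |((∫ ω : EuclideanSpace ℝ ι, exp (-U (ω + ψ)) ∂(multivariateGaussian 0 (A * Aᵀ)))⁻¹ •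
            (∫ ω : EuclideanSpace ℝ ι, exp (-U (ω + ψ)) • (U'' (ω + ψ) - (U' (ω + ψ)).smulRight (U' (ω + ψ))) ∂(multivariateGaussian 0 (A * Aᵀ))) +
            (((∫ ω : EuclideanSpace ℝ ι, exp (-U (ω + ψ)) ∂(multivariateGaussian 0 (A * Aᵀ))) ^ 2)⁻¹ • ∫ ω : EuclideanSpace ℝ ι, exp (-U (ω + ψ)) •
              U' (ω + ψ) ∂(multivariateGaussian 0 (A * Aᵀ))).smulRight
            (∫ ω : EuclideanSpace ℝ ι, exp (-U (ω + ψ)) • U' (ω + ψ) ∂(multivariateGaussian 0 (A * Aᵀ)))) (EuclideanSpace.single x' (1 : ℝ))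
          (EuclideanSpace.single x (1 : ℝ))|) ≤
      t ^ 2 * n * M * (hrϑ + dθ * αθ * (dθ' * αθc) / (1 - lamA)) := by
  obtain ⟨v₀⟩ : Nonempty ι := inferInstance
  have hϑ₂0 : ∀ a b, 0 ≤ ϑ₂ a b := fun a b => (zero_le_one.trans (hϑ1 a b)).trans (hϑ12 a b)
  have hhr0 : 0 ≤ hrϑ := letter_nonneg₁ (fun b => mul_nonneg (hϑ₂0 v₀ b) (hHk0 v₀ b)) (hhrw v₀)
  have hhc0 : 0 ≤ hcϑ := letter_nonneg₁ (fun b => mul_nonneg (hϑ₂0 v₀ b) (hHk0 b v₀)) (hhc v₀)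
  have hαθ0 : 0 ≤ αθ := (mul_nonneg hhr0 hαrσ).trans hαθ
  have hαθc0 : 0 ≤ αθc := (mul_nonneg hhc0 hαcσ).trans hαθc
  have hinc : 0 ≤ dθ * αθ * (dθ' * αθc) / (1 - lamA) := div_nonneg (mul_nonneg (mul_nonneg hdθ hαθ0) (mul_nonneg hdθ' hαθc0)) (by linarith)
  refine weighted_coarse_rowsum_le β hfib
      (fun v u' =>
        |((∫ ω : EuclideanSpace ℝ ι, exp (-U (ω + ψ)) ∂(multivariateGaussian 0 (A * Aᵀ)))⁻¹ •
          (∫ ω : EuclideanSpace ℝ ι, exp (-U (ω + ψ)) • (U'' (ω + ψ) - (U' (ω + ψ)).smulRight (U' (ω + ψ))) ∂(multivariateGaussian 0 (A * Aᵀ))) +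
          (((∫ ω : EuclideanSpace ℝ ι, exp (-U (ω + ψ)) ∂(multivariateGaussian 0 (A * Aᵀ))) ^ 2)⁻¹ • ∫ ω : EuclideanSpace ℝ ι, exp (-U (ω + ψ)) • U'
            (ω + ψ) ∂(multivariateGaussian 0 (A * Aᵀ))).smulRight
          (∫ ω : EuclideanSpace ℝ ι, exp (-U (ω + ψ)) • U' (ω + ψ) ∂(multivariateGaussian 0 (A * Aᵀ)))) (EuclideanSpace.single u' (1 : ℝ))
        (EuclideanSpace.single v (1 : ℝ))|) (fun _ _ => abs_nonneg _) hM hϑc (add_nonneg hhr0 hinc) (fun v => ?_) t y₁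
  exact (Finset.sum_congr rfl fun u' _ => mul_comm _ _).trans_le
      (classmap_two_row hΓop Y hUd hU'd hU''c hκ₀ hκ₁ ha hκ₂ hτ hδ hθ0 hθ1 hκθ hκθw hstab hU'b hU''b hHk hHk0 ψ hαr hαc hhr hlam hlam1 hγ hγ1 hD hDC
        hθnn hDθr hdθ hDθc hdθ' hσ0 hσθ hϑ1 hϑ12 hϑ₂symm hϑσ hσA0 hσϑ₂ hAr hαrσ hAc hαcσ hhrw hhc hαθ hαθc v)

/-- **ONE FULL STEP AT ORDER 2, COLUMNS**: `Σ_{y₂} ϑc(y₁,y₂)·K′(y₂,y₁) ≤ t²·n·M·(hcϑ + dθ·αθ·dθ′·αθc∕(1−lamA))` (the next input's column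
letter in the slot shape; `ϑ` symmetric). [folklore] -/
theorem classmap_two_step_col [Nonempty ι] [Nonempty κ] (hΓop : (γop • (1 : Matrix ι ι ℝ) - A * Aᵀ).PosSemidef) (Y : Finset ι)
    (hUd : ∀ φ : EuclideanSpace ℝ ι, HasFDerivAt U (U' φ) φ) (hU'd : ∀ φ : EuclideanSpace ℝ ι, HasFDerivAt U' (U'' φ) φ) (hU''c : Continuous U'')
    (hκ₀ : 0 ≤ κ₀) (hκ₁ : 0 ≤ κ₁) (ha : 0 ≤ a) (hκ₂ : 0 ≤ κ₂) (hτ : 0 < τ) (hδ : 0 < δ) (hθ0 : 0 < θp) (hθ1 : θp < 1)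
    (hκθ : (2 * κ₀ * (1 + τ) + 4 * δ) * γop ≤ θp) (hκθw : 2 * κ₀ * (1 + τ) * γop + 4 * δ ≤ θp)
    (hstab : ∀ φ : EuclideanSpace ℝ ι, -(κ₀ * ∑ x ∈ Y, φ x ^ 2) ≤ U φ) (hU'b : ∀ φ : EuclideanSpace ℝ ι, ‖U' φ‖ ≤ κ₁ * (a + ∑ x ∈ Y, φ x ^ 2))
    (hU''b : ∀ φ : EuclideanSpace ℝ ι, ‖U'' φ‖ ≤ κ₂)
    (hHk : ∀ (φ : EuclideanSpace ℝ ι) (x z : ι), |U'' φ (EuclideanSpace.single z (1 : ℝ)) (EuclideanSpace.single x (1 : ℝ))| ≤ Hk x z)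
    (hHk0 : ∀ v u, 0 ≤ Hk v u) (ψ : EuclideanSpace ℝ ι) (hαr : ∀ u, ∑ w, |A u w| ≤ αr) (hαc : ∀ w, ∑ u, |A u w| ≤ αc) (hhr : ∀ v, ∑ u, Hk v u ≤ hr)
    (hlam : ∀ x : κ, ∑ u, ∑ v, |A u x| * |A v x| * Hk v u ≤ lamA) (hlam1 : lamA < 1) (hγ : αc * hr * αr / (1 - lamA) ≤ γ) (hγ1 : γ < 1)
    (hD : ∀ x y, 0 ≤ D x y)
    (hDC : ∀ x y, (if x = y then (1 : ℝ) else 0) + ∑ z, D x z * ((if y = z then 0 else ∑ u, ∑ v, |A u y| * |A v z| * Hk v u) / (1 - lamA)) ≤ D x y)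
    (hθnn : ∀ z w, 0 ≤ θ z w) (hDθr : ∀ z', ∑ w, D z' w * θ z' w ≤ dθ) (hdθ : 0 ≤ dθ) (hDθc : ∀ w, ∑ z', D z' w * θ z' w ≤ dθ') (hdθ' : 0 ≤ dθ')
    (hσ0 : ∀ x w, 0 ≤ σ x w) (hσθ : ∀ x z' w, σ x w ≤ σ x z' * θ z' w) (hϑ1 : ∀ x y, 1 ≤ ϑ x y) (hϑ12 : ∀ x y, ϑ x y ≤ ϑ₂ x y)
    (hϑ₂symm : ∀ x y, ϑ₂ x y = ϑ₂ y x) (hϑσ : ∀ x z w, ϑ x z ≤ σ x w * σ z w)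
    (hσA0 : ∀ u z', 0 ≤ σA u z') (hσϑ₂ : ∀ v u z', σ v z' ≤ ϑ₂ v u * σA u z') (hAr : ∀ u, ∑ z', |A u z'| * σA u z' ≤ αrσ) (hαrσ : 0 ≤ αrσ)
    (hAc : ∀ z', ∑ u, |A u z'| * σA u z' ≤ αcσ) (hαcσ : 0 ≤ αcσ)
    (hhrw : ∀ a, ∑ b, ϑ₂ a b * Hk a b ≤ hrϑ) (hhc : ∀ a, ∑ b, ϑ₂ a b * Hk b a ≤ hcϑ)
    (hαθ : hrϑ * αrσ ≤ αθ) (hαθc : hcϑ * αcσ ≤ αθc) (hϑsymm : ∀ x y, ϑ x y = ϑ y x)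
    {ι' : Type} [Fintype ι'] [DecidableEq ι'] (β : ι → ι') {n : ℕ} (hfib : ∀ y, (Finset.univ.filter fun x => β x = y).card ≤ n) {ϑc : ι' → ι' → ℝ}
    {M : ℝ} (hM : 0 ≤ M) (hϑc : ∀ x x', ϑc (β x) (β x') ≤ M * ϑ x x') (t : ℝ) (y₁ : ι') :
    ∑ y₂, ϑc y₁ y₂ *
        (t ^ 2 * ∑ x ∈ Finset.univ.filter (fun x => β x = y₂), ∑ x' ∈ Finset.univ.filter (fun x' => β x' = y₁),
          |((∫ ω : EuclideanSpace ℝ ι, exp (-U (ω + ψ)) ∂(multivariateGaussian 0 (A * Aᵀ)))⁻¹ •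
            (∫ ω : EuclideanSpace ℝ ι, exp (-U (ω + ψ)) • (U'' (ω + ψ) - (U' (ω + ψ)).smulRight (U' (ω + ψ))) ∂(multivariateGaussian 0 (A * Aᵀ))) +
            (((∫ ω : EuclideanSpace ℝ ι, exp (-U (ω + ψ)) ∂(multivariateGaussian 0 (A * Aᵀ))) ^ 2)⁻¹ • ∫ ω : EuclideanSpace ℝ ι, exp (-U (ω + ψ)) •
              U' (ω + ψ) ∂(multivariateGaussian 0 (A * Aᵀ))).smulRight
            (∫ ω : EuclideanSpace ℝ ι, exp (-U (ω + ψ)) • U' (ω + ψ) ∂(multivariateGaussian 0 (A * Aᵀ)))) (EuclideanSpace.single x' (1 : ℝ))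
          (EuclideanSpace.single x (1 : ℝ))|) ≤
      t ^ 2 * n * M * (hcϑ + dθ * αθ * (dθ' * αθc) / (1 - lamA)) := by
  obtain ⟨v₀⟩ : Nonempty ι := inferInstance
  have hϑ₂0 : ∀ a b, 0 ≤ ϑ₂ a b := fun a b => (zero_le_one.trans (hϑ1 a b)).trans (hϑ12 a b)
  have hhr0 : 0 ≤ hrϑ := letter_nonneg₁ (fun b => mul_nonneg (hϑ₂0 v₀ b) (hHk0 v₀ b)) (hhrw v₀)
  have hhc0 : 0 ≤ hcϑ := letter_nonneg₁ (fun b => mul_nonneg (hϑ₂0 v₀ b) (hHk0 b v₀)) (hhc v₀)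
  have hαθ0 : 0 ≤ αθ := (mul_nonneg hhr0 hαrσ).trans hαθ
  have hαθc0 : 0 ≤ αθc := (mul_nonneg hhc0 hαcσ).trans hαθc
  have hinc : 0 ≤ dθ * αθ * (dθ' * αθc) / (1 - lamA) := div_nonneg (mul_nonneg (mul_nonneg hdθ hαθ0) (mul_nonneg hdθ' hαθc0)) (by linarith)
  refine weighted_coarse_colsum_le β hfib
      (fun v u' =>
        |((∫ ω : EuclideanSpace ℝ ι, exp (-U (ω + ψ)) ∂(multivariateGaussian 0 (A * Aᵀ)))⁻¹ •
          (∫ ω : EuclideanSpace ℝ ι, exp (-U (ω + ψ)) • (U'' (ω + ψ) - (U' (ω + ψ)).smulRight (U' (ω + ψ))) ∂(multivariateGaussian 0 (A * Aᵀ))) +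
          (((∫ ω : EuclideanSpace ℝ ι, exp (-U (ω + ψ)) ∂(multivariateGaussian 0 (A * Aᵀ))) ^ 2)⁻¹ • ∫ ω : EuclideanSpace ℝ ι, exp (-U (ω + ψ)) • U'
            (ω + ψ) ∂(multivariateGaussian 0 (A * Aᵀ))).smulRight
          (∫ ω : EuclideanSpace ℝ ι, exp (-U (ω + ψ)) • U' (ω + ψ) ∂(multivariateGaussian 0 (A * Aᵀ)))) (EuclideanSpace.single u' (1 : ℝ))
        (EuclideanSpace.single v (1 : ℝ))|) (fun _ _ => abs_nonneg _) hM hϑc (add_nonneg hhc0 hinc) (fun a => ?_) t y₁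
  exact (Finset.sum_congr rfl fun b _ => by rw [hϑsymm a b, mul_comm]).trans_le
      (classmap_two_col hΓop Y hUd hU'd hU''c hκ₀ hκ₁ ha hκ₂ hτ hδ hθ0 hθ1 hκθ hκθw hstab hU'b hU''b hHk hHk0 ψ hαr hαc hhr hlam hlam1 hγ hγ1 hD hDC
        hθnn hDθr hdθ hDθc hdθ' hσ0 hσθ hϑ1 hϑ12 hϑ₂symm hϑσ hσA0 hσϑ₂ hAr hαrσ hAc hαcσ hhrw hhc hαθ hαθc a)

/-! ## Toy -/

/-- Toy (one step in numbers): a letter `5` becomes at most `t²·n·M·5 = 1·16·2·5 = 160` one scale up (`t = 1`, `n = 16`, `M = 2`). -/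
example : (1 : ℝ) ^ 2 * 16 * 2 * 5 = 160 := by norm_num

end Summit.QuantumFields.BalabanUV.T4Continuum.NE7b.SupWeightedClassMapOrderTwoStep

end
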